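import Literature.NumberTheory.Automorphic.MeyerCompactTest
import Mathlib.Analysis.Calculus.DSlope
import Mathlib.Analysis.Complex.CauchyIntegral
import Mathlib.Analysis.Analytic.IsolatedZeros
import HarnessLib

/-!
# Meyer's global difference representation — proofs, `K = ℚ`: divided differences of `e^{az}` and
# the defect test functions of the Jordan chains

Topic `NumberTheory/Automorphic`; namespace `Literature.NumberTheory.Automorphic.Meyer`. Sibling
PROOF file for Step D (lower bound) of the plan for `Meyer.spectralRealisation_rat`
[Meyer2005, Thm. 5.11].

Translating a Jordan chain `r_j = R_s^j h₀` for the character `|x|^s` by `g ∈ C_ℚ` (`a = log |g|`)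
multiplies Fourier–Laplace transforms by `e^{az}`; the bookkeeping of `e^{az} Z(z)/(z-s)^j` against
the chain is governed by the iterated divided differences of `z ↦ e^{az}` at `s`,

  `E₀ = dslope (e^{a·}) s`, `E_{i+1} = dslope E_i s`   (`expSlope a s i`),

entire functions with `e^{az} - e^{as} = ∑_{i<k} E_i(s) (z-s)^{i+1} + (z-s)^{k+1} E_k(z)`
(`exp_sub_exp_eq_sum_add`). The remainders `E_i · MG₀` are Mellin transforms of explicit compact
test functions `G_i` built from `G₀` by dilation, `D_s`-free linear corrections and the
multiplicative primitive `R_s` of `MeyerCompactTest` (`defectTest`), each step using only the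
VALUE `M(·)(s) = 0` (`mellin_defectTest`); these are the archimedean data of the defect vectors
`λ_g r_j - e^{as} r_j - ∑ E_i(s) r_{j-1-i} ∈ H₊ ∩ H₋`. [Meyer2005, Thm. 5.11: the spectral
multiplicity of `|x|^s` in `π₋` is realised on `R_s`-chains.]

Everything is proved; the definitions are `expSlope`, `preDefect`/`defectTest`.

## References

* R. Meyer, *On a representation of the idele class group related to primes and zeros of
  L-functions*, Duke Math. J. 127 (2005) = arXiv:math/0311468, Thm. 5.11 [Meyer2005].
-/

noncomputable section

open MeasureTheory Set Filter Complex
open scoped Topology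

namespace Literature.NumberTheory.Automorphic.Meyer

/-! ### Entire functions agreeing after multiplication by `z - s` -/

/-- Cancellation of `z - s` between continuous functions. [folklore] -/
theorem eq_of_sub_mul_eq {F G : ℂ → ℂ} (hF : Continuous F) (hG : Continuous G) (s : ℂ)
    (h : ∀ z : ℂ, (z - s) * F z = (z - s) * G z) : F = G := by
  refine Continuous.ext_on (dense_compl_singleton s) hF hG fun z hz => ?_
  have hz' : z - s ≠ 0 := sub_ne_zero.mpr hz
  exact mul_left_cancel₀ hz' (h z)

/-! ### Divided differences of `z ↦ e^{az}` at `s` -/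

/-- **Iterated divided differences `E_i` of `z ↦ e^{az}` at `s`.** [folklore] -/
def expSlope (a s : ℂ) : ℕ → ℂ → ℂ
  | 0 => dslope (fun z : ℂ => cexp (a * z)) s
  | i + 1 => dslope (expSlope a s i) s

/-- `dslope` of an entire function is entire (private copy of the generic lemma also proved in
`NymanBeurlingVectorsOrthogonal`, which is not imported into this cone). [folklore] -/
private theorem differentiable_dslope {f : ℂ → ℂ} (hf : Differentiable ℂ f) (s : ℂ) : Differentiable ℂ (dslope f s) := by
  intro z
  by_cases hz : z = s
  · subst hz
    obtain ⟨p, hp⟩ := hf.analyticAt z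
    exact (hp.has_fpower_series_dslope_fslope).analyticAt.differentiableAt
  · exact (differentiableAt_dslope_of_ne hz).mpr (hf z)

/-- **The divided differences are entire.** [folklore] -/
theorem differentiable_expSlope (a s : ℂ) : ∀ i : ℕ, Differentiable ℂ (expSlope a s i)
  | 0 => by
      rw [expSlope]
      exact differentiable_dslope (by fun_prop) s
  | i + 1 => by
      rw [expSlope]
      exact differentiable_dslope (differentiable_expSlope a s i) s

/-- The first divided difference: `e^{az} - e^{as} = (z - s) E₀(z)`. [folklore] -/
theorem exp_sub_exp_eq (a s z : ℂ) : cexp (a * z) - cexp (a * s) = (z - s) * expSlope a s 0 z := by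
  have h := sub_smul_dslope (fun z : ℂ => cexp (a * z)) s z
  rw [smul_eq_mul] at h
  rw [expSlope, h]

/-- The recursion: `E_i(z) = E_i(s) + (z - s) E_{i+1}(z)`. [folklore] -/
theorem expSlope_eq (a s : ℂ) (i : ℕ) (z : ℂ) :
    expSlope a s i z = expSlope a s i s + (z - s) * expSlope a s (i + 1) z := by
  have h := sub_smul_dslope (expSlope a s i) s z
  rw [smul_eq_mul] at h
  rw [show expSlope a s (i + 1) = dslope (expSlope a s i) s from rfl, h]
  ring

/-- **Telescoping**: `e^{az} - e^{as} = ∑_{i<k} E_i(s) (z-s)^{i+1} + (z-s)^{k+1} E_k(z)`. [folklore] -/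
theorem exp_sub_exp_eq_sum_add (a s : ℂ) (k : ℕ) (z : ℂ) :
    cexp (a * z) - cexp (a * s) =
      ∑ i ∈ Finset.range k, expSlope a s i s * (z - s) ^ (i + 1) + (z - s) ^ (k + 1) * expSlope a s k z := by
  induction k with
  | zero => rw [Finset.sum_range_zero, zero_add, zero_add, pow_one, exp_sub_exp_eq]
  | succ k ih =>
      rw [ih, Finset.sum_range_succ, expSlope_eq a s k z]
      ring

/-! ### Mellin linearity on compact test functions -/

namespace IsCompactTest

variable {G H : ℝ → ℂ}

/-- `M(G - H) = MG - MH`. [folklore] -/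
theorem mellin_sub (hG : IsCompactTest G) (hH : IsCompactTest H) (z : ℂ) :
    mellin (G - H) z = mellin G z - mellin H z := by
  rw [mellin, mellin, mellin, ← integral_sub (hG.mellinConvergent z) (hH.mellinConvergent z)]
  refine setIntegral_congr_fun measurableSet_Ioi fun t _ => ?_
  simp only [Pi.sub_apply, smul_eq_mul, mul_sub]

/-- `M(cG) = c MG`. [folklore] -/
theorem mellin_const_mul (G : ℝ → ℂ) (c z : ℂ) : mellin (fun t => c * G t) z = c * mellin G z := by
  rw [mellin, mellin, ← integral_const_mul]
  refine setIntegral_congr_fun measurableSet_Ioi fun t _ => ?_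
  simp only [smul_eq_mul]
  ring

end IsCompactTest

/-- The dilation factor: `(e^{-a})^{-z} = e^{az}` for real `a`. [folklore] -/
theorem ofReal_exp_neg_cpow (a : ℝ) (z : ℂ) : ((Real.exp (-a) : ℝ) : ℂ) ^ (-z) = cexp (a * z) := by
  rw [Complex.ofReal_exp, Complex.cpow_def_of_ne_zero (Complex.exp_ne_zero _),
    Complex.log_exp (by simp [Real.pi_pos]) (by simpa using Real.pi_pos.le)]
  push_cast
  ring_nf

/-! ### The defect test functions -/

section Defect

variable (G₀ : ℝ → ℂ) (s : ℂ) (a : ℝ)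

/-- **The defect test functions.** `preDefect 0 = G₀(e^{-a}·) - e^{as} G₀`,
`defectTest i = R_s (preDefect i)`, `preDefect (i+1) = defectTest i - E_i(s) G₀`. [cite: Meyer2005, Thm. 5.11] -/
def preDefect : ℕ → ℝ → ℂ
  | 0 => fun t => G₀ (Real.exp (-a) * t) - cexp (a * s) * G₀ t
  | i + 1 => fun t => mulPrimitive s (preDefect i) t - expSlope a s i s * G₀ t

/-- `G_i = R_s (preDefect i)`. [cite: Meyer2005, Thm. 5.11] -/
def defectTest (i : ℕ) : ℝ → ℂ := mulPrimitive s (preDefect G₀ s a i)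

variable {G₀}

/-- The defect package at stage `i`: compact support and the Mellin formula
`M(preDefect i)(z) = (z - s) E_i(z) MG₀(z)`. [cite: Meyer2005, Thm. 5.11] -/
theorem preDefect_package (hG₀ : IsCompactTest G₀) : ∀ i : ℕ,
    IsCompactTest (preDefect G₀ s a i) ∧
      ∀ z : ℂ, mellin (preDefect G₀ s a i) z = (z - s) * expSlope a s i z * mellin G₀ z
  | 0 => by
      have hdil := hG₀.dilate (Real.exp_pos (-a))
      have hc := hG₀.const_mul (cexp (a * s))
      refine ⟨?_, fun z => ?_⟩
      · have h := hdil.sub hc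
        exact h
      · have h := hdil.mellin_sub hc z
        have heq : ((fun t => G₀ (Real.exp (-a) * t)) - fun t => cexp (a * s) * G₀ t) = preDefect G₀ s a 0 := rfl
        rw [heq] at h
        rw [h, IsCompactTest.mellin_dilate G₀ (Real.exp_pos (-a)), IsCompactTest.mellin_const_mul,
          ofReal_exp_neg_cpow, ← sub_mul, exp_sub_exp_eq a s z]
  | i + 1 => by
      obtain ⟨hP, hPm⟩ := preDefect_package hG₀ i
      have hPs : mellin (preDefect G₀ s a i) s = 0 := by rw [hPm s, sub_self, zero_mul, zero_mul]
      have hR : IsCompactTest (mulPrimitive s (preDefect G₀ s a i)) := isCompactTest_mulPrimitive s hP hPs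
      -- `M(R_s P_i) = E_i MG₀`
      have hRm : mellin (mulPrimitive s (preDefect G₀ s a i)) = fun z => expSlope a s i z * mellin G₀ z := by
        refine eq_of_sub_mul_eq hR.differentiable_mellin.continuous
          (((differentiable_expSlope a s i).mul hG₀.differentiable_mellin).continuous) s fun z => ?_
        rw [mellin_mulPrimitive s hP hPs z, hPm z]
        ring
      have hc := hG₀.const_mul (expSlope a s i s)
      refine ⟨?_, fun z => ?_⟩
      · have h := hR.sub hc
        exact h
      · have h := hR.mellin_sub hc z
        have heq : ((mulPrimitive s (preDefect G₀ s a i)) - fun t => expSlope a s i s * G₀ t) =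
            preDefect G₀ s a (i + 1) := rfl
        rw [heq] at h
        rw [h, hRm, IsCompactTest.mellin_const_mul]
        simp only
        rw [expSlope_eq a s i z]
        ring

/-- **`G_i` is a compact test function.** [cite: Meyer2005, Thm. 5.11] -/
theorem isCompactTest_defectTest (hG₀ : IsCompactTest G₀) (i : ℕ) : IsCompactTest (defectTest G₀ s a i) := by
  obtain ⟨hP, hPm⟩ := preDefect_package s a hG₀ i
  have hPs : mellin (preDefect G₀ s a i) s = 0 := by rw [hPm s, sub_self, zero_mul, zero_mul]
  exact isCompactTest_mulPrimitive s hP hPs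

/-- **`M(G_i)(z) = E_i(z) MG₀(z)`** for all `z`. [cite: Meyer2005, Thm. 5.11] -/
theorem mellin_defectTest (hG₀ : IsCompactTest G₀) (i : ℕ) (z : ℂ) :
    mellin (defectTest G₀ s a i) z = expSlope a s i z * mellin G₀ z := by
  obtain ⟨hP, hPm⟩ := preDefect_package s a hG₀ i
  have hPs : mellin (preDefect G₀ s a i) s = 0 := by rw [hPm s, sub_self, zero_mul, zero_mul]
  have hR : IsCompactTest (mulPrimitive s (preDefect G₀ s a i)) := isCompactTest_mulPrimitive s hP hPs
  have hRm : mellin (mulPrimitive s (preDefect G₀ s a i)) = fun z => expSlope a s i z * mellin G₀ z := by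
    refine eq_of_sub_mul_eq hR.differentiable_mellin.continuous
      (((differentiable_expSlope a s i).mul hG₀.differentiable_mellin).continuous) s fun z => ?_
    rw [mellin_mulPrimitive s hP hPs z, hPm z]
    ring
  exact congrFun hRm z

/-- `∫ G_i = E_i(1) ∫ G₀`; in particular `∫ G_i = 0` when `∫ G₀ = 0`. [folklore] -/
theorem integral_defectTest_eq_zero (hG₀ : IsCompactTest G₀) (h0 : ∫ t : ℝ, G₀ t = 0) (i : ℕ) :
    ∫ t : ℝ, defectTest G₀ s a i t = 0 := by
  rw [(isCompactTest_defectTest s a hG₀ i).integral_eq_mellin_one, mellin_defectTest s a hG₀ i 1,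
    ← hG₀.integral_eq_mellin_one, h0, mul_zero]

end Defect

end Literature.NumberTheory.Automorphic.Meyer
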